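import Mathlib
import HarnessLib
import Summits.HubbardSuperconductivity.HubbardSuperconductivity.Theorems.FunctionFieldCertificateWindowInfraredBoundReductions

/-!
# Crux-strategist s1 (second instance, "s1b") sketch — crux `WindowInfraredBound` (stmt-HubbardSuperconductivity-1089)

STRATEGY-CENSUS-s1b.md §Decomposition, attempt D-s1.4 (condensate-threshold split). Typed, with the glue PROVED,
so that the census entry is kernel-checked; NOT filed as a route split (both pieces are ownerless, see the
census). Vocabulary: `wib_iff_pairStructureFactor` (crux in tree vocabulary, `Iff.rfl`).

* `WibBelowThreshold` — at every `(U, δ)` there is a threshold `θ > 0` such that every sector ground state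
  whose ZERO-MOMENTUM `d`-wave pair weight is sub-threshold, `S_ψ(0) ≤ θ L²` (no condensate at scale θ),
  obeys the window law `T_ε(ψ) ≤ C ε L²` ("no condensate ⇒ no soft window": the NORMAL-STATE half);
* `WibAboveThreshold` — for every threshold `θ > 0`, every sector ground state with `S_ψ(0) > θ L²`
  (a condensate of density > θ) obeys the window law (the GOLDSTONE / phase-stiffness half);
* `windowInfraredBound_of_threshold` — the two halves give the crux (case split per state; constants
  `max C₁ C₂`, `min ε₁ ε₂`, `max L₁ L₂`).
-/

namespace Summit.HubbardSuperconductivity.HubbardSuperconductivity.Cruxes.WindowInfraredBound.CondensateThreshold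

set_option linter.dupNamespace false

open Literature.MathematicalPhysics.QuantumLattice Literature.Probability.LatticeModels Matrix Finset
open scoped ComplexOrder ComplexConjugate
open Summit.HubbardSuperconductivity.HubbardSuperconductivity.Theses
open Summit.HubbardSuperconductivity.HubbardSuperconductivity.Theorems

/-- Normal-state half: sub-threshold condensate ⇒ window law (threshold chosen per `(U, δ)`). -/
def WibBelowThreshold : Prop :=
  ∀ U : ℝ, 0 < U → ∀ δ ∈ Set.Ioo (0:ℝ) (1 / 2), ∃ θ C ε₀ : ℝ, 0 < θ ∧ 0 ≤ C ∧ 0 < ε₀ ∧ ∃ L₀ : ℕ,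
    ∀ ε ∈ Set.Ioc (0:ℝ) ε₀, ∀ (L : ℕ) [NeZero L], L₀ ≤ L → Even L →
      ∀ ψ : Fock (Orb (FermionTorus 2 L)), star ψ ⬝ᵥ ψ = 1 →
        IsGroundStateInSector (hubbardTorus 2 L 1 U) (2 * ⌊(1 - δ) * (L : ℝ) ^ 2 / 2⌋₊) 0 ψ →
          pairStructureFactor dWaveFormFactor L ψ 0 ≤ θ * (L : ℝ) ^ 2 →
            (∑ m : TorusSite 2 L, if m ≠ 0 ∧ momentumNormSq L m ≤ ε ^ 2 then
                pairStructureFactor dWaveFormFactor L ψ m else 0) ≤ C * ε * (L : ℝ) ^ 2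

/-- Goldstone half: for every threshold, a super-threshold condensate ⇒ window law. -/
def WibAboveThreshold : Prop :=
  ∀ U : ℝ, 0 < U → ∀ δ ∈ Set.Ioo (0:ℝ) (1 / 2), ∀ θ : ℝ, 0 < θ → ∃ C ε₀ : ℝ, 0 ≤ C ∧ 0 < ε₀ ∧ ∃ L₀ : ℕ,
    ∀ ε ∈ Set.Ioc (0:ℝ) ε₀, ∀ (L : ℕ) [NeZero L], L₀ ≤ L → Even L →
      ∀ ψ : Fock (Orb (FermionTorus 2 L)), star ψ ⬝ᵥ ψ = 1 →
        IsGroundStateInSector (hubbardTorus 2 L 1 U) (2 * ⌊(1 - δ) * (L : ℝ) ^ 2 / 2⌋₊) 0 ψ →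
          θ * (L : ℝ) ^ 2 < pairStructureFactor dWaveFormFactor L ψ 0 →
            (∑ m : TorusSite 2 L, if m ≠ 0 ∧ momentumNormSq L m ≤ ε ^ 2 then
                pairStructureFactor dWaveFormFactor L ψ m else 0) ≤ C * ε * (L : ℝ) ^ 2

/-- **Glue (kernel-checked): the two halves give the crux.** -/
theorem windowInfraredBound_of_threshold (hlo : WibBelowThreshold) (hhi : WibAboveThreshold) :
    FunctionFieldCertificate.WindowInfraredBound := by
  rw [wib_iff_pairStructureFactor]
  intro U hU δ hδ
  obtain ⟨θ, C₁, ε₁, hθ, hC₁, hε₁, L₁, h₁⟩ := hlo U hU δ hδ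
  obtain ⟨C₂, ε₂, hC₂, hε₂, L₂, h₂⟩ := hhi U hU δ hδ θ hθ
  refine ⟨max C₁ C₂, min ε₁ ε₂, le_max_of_le_left hC₁, lt_min hε₁ hε₂, max L₁ L₂, ?_⟩
  intro ε hε L _ hL hEven ψ hψ hGS
  have hε0 : 0 ≤ ε := hε.1.le
  have hL2 : 0 ≤ (L : ℝ) ^ 2 := sq_nonneg _
  rcases le_or_gt (pairStructureFactor dWaveFormFactor L ψ 0) (θ * (L : ℝ) ^ 2) with h | h
  · calc (∑ m : TorusSite 2 L, if m ≠ 0 ∧ momentumNormSq L m ≤ ε ^ 2 then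
              pairStructureFactor dWaveFormFactor L ψ m else 0)
          ≤ C₁ * ε * (L : ℝ) ^ 2 :=
            h₁ ε ⟨hε.1, hε.2.trans (min_le_left _ _)⟩ L (le_of_max_le_left hL) hEven ψ hψ hGS h
      _ ≤ max C₁ C₂ * ε * (L : ℝ) ^ 2 := by
            apply mul_le_mul_of_nonneg_right _ hL2
            exact mul_le_mul_of_nonneg_right (le_max_left _ _) hε0
  · calc (∑ m : TorusSite 2 L, if m ≠ 0 ∧ momentumNormSq L m ≤ ε ^ 2 then
              pairStructureFactor dWaveFormFactor L ψ m else 0)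
          ≤ C₂ * ε * (L : ℝ) ^ 2 :=
            h₂ ε ⟨hε.1, hε.2.trans (min_le_right _ _)⟩ L (le_of_max_le_right hL) hEven ψ hψ hGS h
      _ ≤ max C₁ C₂ * ε * (L : ℝ) ^ 2 := by
            apply mul_le_mul_of_nonneg_right _ hL2
            exact mul_le_mul_of_nonneg_right (le_max_right _ _) hε0

/-- The Kac route's copy (the two route decls are the same term). -/
theorem kacWindowInfraredBound_of_threshold (hlo : WibBelowThreshold) (hhi : WibAboveThreshold) :
    KacWindowPenalty.WindowInfraredBound :=
  wib_functionField_iff_kac.1 (windowInfraredBound_of_threshold hlo hhi)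

/-- Converse bookkeeping: the crux gives both halves (so the split loses nothing). -/
theorem threshold_of_windowInfraredBound (h : FunctionFieldCertificate.WindowInfraredBound) :
    WibBelowThreshold ∧ WibAboveThreshold := by
  rw [wib_iff_pairStructureFactor] at h
  refine ⟨fun U hU δ hδ => ?_, fun U hU δ hδ θ _ => ?_⟩
  · obtain ⟨C, ε₀, hC, hε₀, L₀, h⟩ := h U hU δ hδ
    exact ⟨1, C, ε₀, one_pos, hC, hε₀, L₀,
      fun ε hε L _ hL hEven ψ hψ hGS _ => h ε hε L hL hEven ψ hψ hGS⟩
  · obtain ⟨C, ε₀, hC, hε₀, L₀, h⟩ := h U hU δ hδ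
    exact ⟨C, ε₀, hC, hε₀, L₀, fun ε hε L _ hL hEven ψ hψ hGS _ => h ε hε L hL hEven ψ hψ hGS⟩

end Summit.HubbardSuperconductivity.HubbardSuperconductivity.Cruxes.WindowInfraredBound.CondensateThreshold
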